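import Literature.MathematicalPhysics.QuantumLattice.TraceReflectionPositivityProofs
import Literature.MathematicalPhysics.QuantumLattice.DuhamelTwoPointProofs
import Literature.MathematicalPhysics.QuantumLattice.HeisenbergFerromagnetNotReflectionPositive
import Literature.LinearAlgebra.Matrix.GramDeterminantKernel
import HarnessLib

/-!
# Reflection positivity is equivalent to positivity of the cross-coupling matrix (Jaffe–Janssens 2016, Thm. 29/31)

Topic `Literature/MathematicalPhysics/QuantumLattice`; companion of `TraceReflectionPositivity.lean`
(Fröhlich–Israel–Lieb–Simon 1978 Thm. 2.1 in the matrix realisation `θ(1 ⊗ F) = F̄ ⊗ 1`, PROVED in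
`TraceReflectionPositivityProofs.lean` as `FrohlichIsraelLiebSimon1978_thm21_matrix_holds`) and of
`HeisenbergFerromagnetNotReflectionPositive.lean` (the two-site ferromagnetic Heisenberg pair, the
smallest instance of the "only if" below). Everything here is PROVED; no named fact is introduced.

## Source (read: `paper:arxiv-1506.04197`, §1 Thm. 1, §4.1–§4.3 pp. 11–12)

A. Jaffe, B. Janssens, *Characterization of reflection positivity: Majoranas and spins*, Commun.
Math. Phys. 346 (2016) 1021–1050 [JaffeJanssens2016]. For a reflection-invariant Hamiltonian
decomposed as `H = H₋ + H₀ + H₊ - E` (§4.1 (4.2)–(4.5)) with `-H₊ = Θ(-H₋)` the interaction inside one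
half, and the interaction ACROSS the reflection plane `-H₀ = Σ_{I,I'} J⁰_{II'} Θ(C_I) C_{I'}`
(`C_I` running over a basis of the algebra `𝔄₊` of one half, `J⁰` "the matrix of coupling constants
across the reflection plane"), and the Boltzmann functional `ω_H(A) = Tr(A e^{-H})`:

* **Theorem 29** (§4.2): "(a) If `J⁰` is positive semidefinite, the functional `ω_H` is reflection
  positive on `𝔄₊`. (b) Conversely, if there exists an `ε > 0` such that `ω_{βH}` is reflection
  positive on `𝔄₊` for all `β ∈ [0, ε)`, then the matrix `J⁰` is positive semidefinite."
  Proof of (b) (p. 12): choose `A` with `Tr(Θ(A) ∘ A) = 0`; "Reflection positivity then ensures that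
  the first derivative cannot be negative, `0 ≤ d/dβ ⟨A,A⟩_{βH,Θ}|_{β=0} = -Tr((Θ(A)∘A)H)`, for
  otherwise reflection positivity would be violated for small `β`", and this derivative evaluates to
  `⟨f, J⁰ f⟩`.
* **Theorem 31** (§4.3): the same equivalence for the Gibbs functional `ρ_H = Z_H⁻¹ ω_H`; with
  Theorem 29 this is the paper's **Theorem 1**: "`ρ_{βH}` is reflection positive for all `0 < β`, if
  and only if `0 ≤ J⁰`."

Jaffe–Janssens state these for Majorana algebras with the twisted product `∘` (and in §6–§7 for
spins). This file proves both directions in the **matrix (tensor-product) realisation of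
Fröhlich–Israel–Lieb–Simon** [FILS1978, §3 example 3], the realisation used throughout this tree
(`TraceReflectionPositivity.lean`, `KroneckerTraceSchwarz.lean`, `GroundStateReflectionPositivity.lean`,
`HeisenbergFerromagnetNotReflectionPositive.lean`): the two halves are the two tensor factors of
`ℂ^m ⊗ ℂ^m`, `𝔄₊ = {1 ⊗ F}`, the reflection is the antilinear `Θ(1 ⊗ F) = F̄ ⊗ 1` (entrywise
conjugate), so that `Θ(F)F = F̄ ⊗ F` and, for observables `C_i` of one half and a coupling matrix
`J`, the exponent `-H` is

  `X(A, C, J) = Ā ⊗ 1 + 1 ⊗ A + Σ_{i,j} J_{ij} • (C̄_i ⊗ C_j)`      (`CouplingMatrixRP.exponent`)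

(`1 ⊗ A = -H₊`, `Ā ⊗ 1 = Θ(-H₊) = -H₋`, the double sum `= -H₀`). Results:

* `CouplingMatrixRP.nonneg_of_posSemidef` — **Thm. 29(a)**: if `J` is positive semidefinite then
  `0 ≤ Re Tr[(F̄ ⊗ F) e^{X}]` and `Im Tr[(F̄ ⊗ F) e^{X}] = 0` for every `F` (write `J = BᴴB` and
  `Σ J_{ij} C̄_i ⊗ C_j = Σ_k D̄_k ⊗ D_k`, `D_k = Σ_j B_{kj} C_j`, then FILS Thm. 2.1);
  `CouplingMatrixRP.nonneg_forall_of_posSemidef` — hence reflection positivity at EVERY `β ≥ 0`.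
* `CouplingMatrixRP.trace_reflect_mul_exponent` — the first-order coefficient: for `Tr F = 0` and
  `w_j = Tr(F C_j)`, `Tr[(F̄ ⊗ F) X] = Σ_{ij} w̄_i J_{ij} w_j = ⟨w, J w⟩` (JJ (4.10)).
* `CouplingMatrixRP.exists_neg_of_neg_direction` — **failure of RP from one negative direction**:
  if `Re ⟨w, Jw⟩ < 0` for the vector `w_j = Tr(F C_j)` of some trace-free `F`, then for every `ε > 0`
  there is `β ∈ (0, ε)` with `Re Tr[(F̄ ⊗ F) e^{βX}] < 0` (the two-site ferromagnetic Heisenberg pair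
  of `HeisenbergFerromagnetNotReflectionPositive.lean` is, after conjugating by `σʸ ⊗ 1`, the instance
  `A = 0`, `C = σ`, coupling matrix `-J·1₃` with `J > 0` in Jaffe–Janssens' sign, `F = σᶻ`).
* `CouplingMatrixRP.posSemidef_of_nonneg` — **Thm. 29(b)**: if `J` is Hermitian, the observables
  `C_j` are DUALLY SPANNED by trace-free matrices (`∀ w ∃ F, Tr F = 0 ∧ Tr(F C_j) = w_j`; this is the
  matrix form of "`{C_I}` is a basis with `C_∅ = 1`", and holds e.g. for trace-free, trace-orthogonal
  families: `CouplingMatrixRP.duallySpanned_of_traceOrthogonal`), and the functional is reflection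
  positive for all `β ∈ (0, ε)`, then `J` is positive semidefinite.
* `CouplingMatrixRP.nonneg_forall_iff_posSemidef` — the equivalence (**Thm. 1 / Thm. 29**) under those
  two standing hypotheses (the Gibbs functional `ρ_H = Z_H⁻¹ ω_H`, **Thm. 31**, has the same signs
  whenever `Z_H > 0`, JJ Remark 28 — not restated here).

* `HeisenbergPairRP.trace_theta_mul_exp_eq`, `HeisenbergPairRP.pair_reflectionPositive_iff` — the
  worked instance: conjugated by `σʸ ⊗ 1`, Jaffe–Janssens' standard-reflection functional of the
  spin-½ Heisenberg pair `H_J = -J Σ_a σ^a ⊗ σ^a` is the functional of `X(0, σ, -J·1₃)`, so **Prop. 38 at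
  two sites holds in both directions**: reflection positive at every `β ≥ 0` iff `J ≤ 0`
  (antiferromagnetic; `HeisenbergPairRP.antiferromagneticPair_reflectionPositive` is the new "if").

NOT here (say so when citing): the Majorana realisation with the `ℤ₂`-graded twisted product `∘` and
the spin realisation with Jaffe–Janssens' phases `i^{k_I+k_I'}` (Thm. 34) — only the FILS tensor-product
realisation; reflection positivity on the Boltzmann functional for `β ∈ [0,ε)` versus all `β` is as
printed (the hypothesis of (b) is the weak one). Relevance (cell `hubbard-cq`, row PC, barrier
bookkeeping): for a GIVEN reflection `Θ` and a `Θ`-symmetric Hamiltonian, reflection positivity for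
all temperatures is decided by the SIGN of the cross-coupling matrix and nothing else — a negative
direction is a genuine failure (not repairable by `ε`), while the Hubbard obstruction recorded in
`Literature/Barriers/HubbardSuperconductivity/LiebReflectionNeedsPiFluxHalfFilling.lean` is the failure
of the SYMMETRY hypothesis `Θ(H_L) = H_R` itself, to which this criterion does not even apply.
-/

noncomputable section

open scoped Matrix.Norms.L2Operator ComplexOrder Kronecker
open Finset Filter Topology NormedSpace Matrix

namespace Literature.MathematicalPhysics.QuantumLattice

namespace CouplingMatrixRP

variable {m ι : Type} [Fintype m] [DecidableEq m] [Fintype ι]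

/-! ### The objects -/

/-- The exponent `-H = Ā ⊗ 1 + 1 ⊗ A + Σ_{i,j} J_{ij} • (C̄_i ⊗ C_j)` of a reflection-symmetric
Hamiltonian in the FILS matrix realisation: `1 ⊗ A` the interaction inside the `+` half, `Ā ⊗ 1` its
reflection, and the interaction across the plane with coupling matrix `J` between the reflected
observables `Θ(C_i) = C̄_i ⊗ 1` and the observables `1 ⊗ C_j`.
[cite: JaffeJanssens2016, §4.1 (4.2)–(4.5)] [cite: FILS1978, §2 (2.1) and §3 example 3] -/
def exponent (A : Matrix m m ℂ) (C : ι → Matrix m m ℂ) (J : Matrix ι ι ℂ) :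
    Matrix (m × m) (m × m) ℂ :=
  A.map (starRingEnd ℂ) ⊗ₖ (1 : Matrix m m ℂ) + (1 : Matrix m m ℂ) ⊗ₖ A +
    ∑ i, ∑ j, J i j • ((C i).map (starRingEnd ℂ) ⊗ₖ C j)

/-- The reflected pairing `Θ(F) F = F̄ ⊗ F` of an observable `1 ⊗ F` of the `+` half with its
reflection `Θ(1 ⊗ F) = F̄ ⊗ 1`. [cite: FILS1978, §3 example 3] -/
def reflectPair (F : Matrix m m ℂ) : Matrix (m × m) (m × m) ℂ :=
  F.map (starRingEnd ℂ) ⊗ₖ F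

/-- The family `C` is DUALLY SPANNED by trace-free matrices: every coefficient vector `w` is realised
as `w_j = Tr(F C_j)` by some `F` with `Tr F = 0`. (Matrix form of Jaffe–Janssens' standing set-up
"`{C_I}` a basis of `𝔄₊` with `C_∅ = 1`": then `A = Σ a_I C_I` with `a_∅ = 0` realises every `f`.)
[cite: JaffeJanssens2016, §4.2 proof of Thm. 29(b)] -/
def DuallySpanned (C : ι → Matrix m m ℂ) : Prop :=
  ∀ w : ι → ℂ, ∃ F : Matrix m m ℂ, F.trace = 0 ∧ ∀ j, (F * C j).trace = w j

omit [DecidableEq m] in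
/-- Trace-free, trace-ORTHOGONAL families are dually spanned: if `Tr C_j = 0`, `Tr(C_jᴴ C_j) = c ≠ 0`
and `Tr(C_iᴴ C_j) = 0` for `i ≠ j` (e.g. the Pauli matrices, `c = 2`; Majorana / Pauli monomials),
then `F = c⁻¹ Σ_i w_i C_iᴴ` realises `w`. [cite: JaffeJanssens2016, Prop. 9 (orthogonality of the monomial basis)] -/
theorem duallySpanned_of_traceOrthogonal {C : ι → Matrix m m ℂ} (htr : ∀ j, (C j).trace = 0)
    {c : ℂ} (hc : c ≠ 0) (hdiag : ∀ j, ((C j)ᴴ * C j).trace = c)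
    (hoff : ∀ i j, i ≠ j → ((C i)ᴴ * C j).trace = 0) :
    DuallySpanned C := by
  intro w
  refine ⟨c⁻¹ • ∑ i, w i • (C i)ᴴ, ?_, fun j => ?_⟩
  · rw [trace_smul, trace_sum]
    simp [trace_smul, trace_conjTranspose, htr]
  · rw [Matrix.smul_mul, Finset.sum_mul, trace_smul, trace_sum,
      Finset.sum_eq_single j (fun i _ hij => by rw [Matrix.smul_mul, trace_smul, hoff i j hij, smul_zero])
        (fun h => absurd (Finset.mem_univ j) h),
      Matrix.smul_mul, trace_smul, hdiag, smul_eq_mul, smul_eq_mul]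
    field_simp

/-! ### Elementary trace bookkeeping -/

omit [DecidableEq m] in
/-- `Tr M̄ = conj (Tr M)`. [folklore] -/
private theorem trace_map_starRingEnd (M : Matrix m m ℂ) :
    (M.map (starRingEnd ℂ)).trace = starRingEnd ℂ M.trace := by
  simp [Matrix.trace, Matrix.map_apply, map_sum]

omit [DecidableEq m] in
/-- `M̄ N̄ = (MN)‾`. [folklore] -/
private theorem map_starRingEnd_mul (M N : Matrix m m ℂ) :
    M.map (starRingEnd ℂ) * N.map (starRingEnd ℂ) = (M * N).map (starRingEnd ℂ) := by
  rw [Matrix.map_mul]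

omit [DecidableEq m] in
/-- `Tr[(F̄ ⊗ F)(X ⊗ Y)] = Tr(F̄ X) · Tr(F Y)` (the trace state factorises over the two halves).
[cite: FILS1978, §3 example 3] -/
theorem trace_reflectPair_mul_kronecker (F X Y : Matrix m m ℂ) :
    (reflectPair F * (X ⊗ₖ Y)).trace = (F.map (starRingEnd ℂ) * X).trace * (F * Y).trace := by
  rw [reflectPair, ← mul_kronecker_mul, trace_kronecker]

omit [DecidableEq m] in
/-- `Tr[(F̄ ⊗ F)(X̄ ⊗ Y)] = conj(Tr(F X)) · Tr(F Y)`. [cite: FILS1978, §3 example 3] -/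
theorem trace_reflectPair_mul_conjKronecker (F X Y : Matrix m m ℂ) :
    (reflectPair F * (X.map (starRingEnd ℂ) ⊗ₖ Y)).trace =
      starRingEnd ℂ (F * X).trace * (F * Y).trace := by
  rw [trace_reflectPair_mul_kronecker, map_starRingEnd_mul, trace_map_starRingEnd]

omit [DecidableEq m] in
/-- `Tr(F̄ ⊗ F) = |Tr F|²` ("`Tr(B θ₁ B) = Tr(Ā ⊗ A) = |Tr A|² ≥ 0`"); in particular it vanishes when
`Tr F = 0`. [cite: FILS1978, §3 example 3] -/
theorem trace_reflectPair (F : Matrix m m ℂ) :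
    (reflectPair F).trace = starRingEnd ℂ F.trace * F.trace := by
  rw [reflectPair, trace_kronecker, trace_map_starRingEnd]

/-! ### Thm. 29(a): a positive semidefinite coupling matrix gives reflection positivity -/

omit [Fintype m] [DecidableEq m] in
/-- Conjugating a linear combination: `(Σ_j b_j • C_j)‾ = Σ_j b̄_j • C̄_j`. [folklore] -/
private theorem map_starRingEnd_sum_smul (b : ι → ℂ) (C : ι → Matrix m m ℂ) :
    (∑ j, b j • C j).map (starRingEnd ℂ) = ∑ j, starRingEnd ℂ (b j) • (C j).map (starRingEnd ℂ) := by
  ext a c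
  simp [Matrix.map_apply, Matrix.sum_apply, Matrix.smul_apply, map_sum, map_mul]

omit [Fintype m] [DecidableEq m] in
/-- **The cross term of a Gram coupling matrix is a sum of reflected squares**: for `J = BᴴB`,
`Σ_{i,j} J_{ij} • (C̄_i ⊗ C_j) = Σ_k D̄_k ⊗ D_k` with `D_k = Σ_j B_{kj} • C_j`.
[cite: JaffeJanssens2016, §3 Thm. 23 (proof: Lemmas 24–25) / §4.2 proof of Thm. 29(a)] -/
theorem sum_smul_conjKronecker_eq_of_gram (B : Matrix ι ι ℂ) (C : ι → Matrix m m ℂ) :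
    ∑ i, ∑ j, (Bᴴ * B) i j • ((C i).map (starRingEnd ℂ) ⊗ₖ C j) =
      ∑ k, (∑ j, B k j • C j).map (starRingEnd ℂ) ⊗ₖ (∑ j, B k j • C j) := by
  ext ⟨a, b⟩ ⟨c, d⟩
  simp only [Matrix.sum_apply, Matrix.smul_apply, kroneckerMap_apply, Matrix.map_apply, smul_eq_mul,
    map_starRingEnd_sum_smul, Matrix.mul_apply, conjTranspose_apply, Complex.star_def]
  -- both sides equal `Σ_i Σ_j Σ_k conj(B k i) B k j conj(C i a c) (C j b d)`
  have hR : ∀ k, (∑ j, starRingEnd ℂ (B k j) * starRingEnd ℂ (C j a c)) * (∑ j, B k j * C j b d) =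
      ∑ i, ∑ j, starRingEnd ℂ (B k i) * B k j * (starRingEnd ℂ (C i a c) * C j b d) := by
    intro k
    rw [Finset.sum_mul]
    refine Finset.sum_congr rfl fun i _ => ?_
    rw [Finset.mul_sum]
    refine Finset.sum_congr rfl fun j _ => ?_
    ring
  simp only [hR]
  conv_rhs => rw [Finset.sum_comm]
  refine Finset.sum_congr rfl fun i _ => ?_
  conv_rhs => rw [Finset.sum_comm]
  refine Finset.sum_congr rfl fun j _ => ?_
  rw [Finset.sum_mul]

/-- **Jaffe–Janssens 2016, Theorem 29(a)** (FILS matrix realisation): if the matrix `J` of couplings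
across the reflection plane is positive semidefinite, the Boltzmann functional is reflection positive —
`Tr[(F̄ ⊗ F) exp(Ā ⊗ 1 + 1 ⊗ A + Σ J_{ij} C̄_i ⊗ C_j)]` is a nonnegative real number for every `F`.
Proof: `J = BᴴB`, the cross term is `Σ_k D̄_k ⊗ D_k`, and Fröhlich–Israel–Lieb–Simon's Theorem 2.1
(`FrohlichIsraelLiebSimon1978_thm21_matrix_holds`) applies.
[cite: JaffeJanssens2016, Thm. 29(a)] [cite: FILS1978, Thm. 2.1 and §3 example 3] -/
theorem nonneg_of_posSemidef (A : Matrix m m ℂ) (C : ι → Matrix m m ℂ) {J : Matrix ι ι ℂ}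
    (hJ : J.PosSemidef) (F : Matrix m m ℂ) :
    0 ≤ (reflectPair F * exp (exponent A C J)).trace.re ∧
      (reflectPair F * exp (exponent A C J)).trace.im = 0 := by
  classical
  obtain ⟨B, rfl⟩ := Literature.LinearAlgebra.Matrix.exists_eq_conjTranspose_mul_self_of_posSemidef hJ
  have h := FrohlichIsraelLiebSimon1978_thm21_matrix_holds m ι A F (fun k => ∑ j, B k j • C j)
  simp only at h
  rw [exponent, sum_smul_conjKronecker_eq_of_gram, reflectPair]
  exact h

omit [Fintype m] [DecidableEq m] [Fintype ι] in
/-- Conjugation commutes with REAL scalars: `((β:ℂ) • A)‾ = (β:ℂ) • Ā`. [folklore] -/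
private theorem map_starRingEnd_real_smul (β : ℝ) (A : Matrix m m ℂ) :
    ((β : ℂ) • A).map (starRingEnd ℂ) = (β : ℂ) • A.map (starRingEnd ℂ) := by
  ext a c
  simp [Matrix.map_apply, Matrix.smul_apply, Complex.conj_ofReal]

omit [Fintype m] in
/-- Scaling the exponent by a real `β` (inverse temperature) scales the one-half interaction and the
coupling matrix: `β • X(A, C, J) = X(βA, C, βJ)`. [cite: JaffeJanssens2016, §4.2 (the family `ω_{βH}`)] -/
theorem real_smul_exponent (β : ℝ) (A : Matrix m m ℂ) (C : ι → Matrix m m ℂ) (J : Matrix ι ι ℂ) :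
    (β : ℂ) • exponent A C J = exponent ((β : ℂ) • A) C ((β : ℂ) • J) := by
  simp only [exponent, smul_add, Finset.smul_sum, map_starRingEnd_real_smul, smul_kronecker,
    kronecker_smul, Matrix.smul_apply, smul_eq_mul, smul_smul]

/-- **Reflection positivity at every temperature** from a positive semidefinite coupling matrix:
`0 ≤ Re Tr[(F̄ ⊗ F) e^{βX}]` (and `Im = 0`) for all `β ≥ 0` and all `F`.
[cite: JaffeJanssens2016, Thm. 1, Thm. 29(a), Thm. 31(a)] -/
theorem nonneg_forall_of_posSemidef (A : Matrix m m ℂ) (C : ι → Matrix m m ℂ) {J : Matrix ι ι ℂ}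
    (hJ : J.PosSemidef) {β : ℝ} (hβ : 0 ≤ β) (F : Matrix m m ℂ) :
    0 ≤ (reflectPair F * exp ((β : ℂ) • exponent A C J)).trace.re ∧
      (reflectPair F * exp ((β : ℂ) • exponent A C J)).trace.im = 0 := by
  rw [real_smul_exponent]
  exact nonneg_of_posSemidef _ C (hJ.smul (Complex.zero_le_real.2 hβ)) F

/-! ### The first-order coefficient `Tr[(F̄ ⊗ F) X] = ⟨w, Jw⟩` -/

/-- **The derivative at `β = 0`** (Jaffe–Janssens (4.10)): for a trace-free `F` with
`w_j = Tr(F C_j)`, `Tr[(F̄ ⊗ F)(Ā ⊗ 1 + 1 ⊗ A + Σ J_{ij} C̄_i ⊗ C_j)] = Σ_{ij} w̄_i J_{ij} w_j = w⋆ ⬝ (J w)`: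
the one-half terms drop out because `Tr F = 0`, and only the cross couplings contribute.
[cite: JaffeJanssens2016, §4.2 proof of Thm. 29(b), eq. (4.10)] -/
theorem trace_reflectPair_mul_exponent (A : Matrix m m ℂ) (C : ι → Matrix m m ℂ) (J : Matrix ι ι ℂ)
    {F : Matrix m m ℂ} (hF : F.trace = 0) {w : ι → ℂ} (hw : ∀ j, (F * C j).trace = w j) :
    (reflectPair F * exponent A C J).trace = star w ⬝ᵥ (J *ᵥ w) := by
  have h1 : (reflectPair F * (A.map (starRingEnd ℂ) ⊗ₖ (1 : Matrix m m ℂ))).trace = 0 := by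
    rw [trace_reflectPair_mul_conjKronecker, Matrix.mul_one, hF, mul_zero]
  have h2 : (reflectPair F * ((1 : Matrix m m ℂ) ⊗ₖ A)).trace = 0 := by
    rw [trace_reflectPair_mul_kronecker, Matrix.mul_one, trace_map_starRingEnd, hF, map_zero, zero_mul]
  simp only [exponent, Matrix.mul_add, Finset.mul_sum, Matrix.mul_smul, trace_add, trace_sum,
    trace_smul, h1, h2, zero_add, trace_reflectPair_mul_conjKronecker, hw, smul_eq_mul]
  simp only [dotProduct, mulVec, Pi.star_apply, Complex.star_def, Finset.mul_sum]
  refine Finset.sum_congr rfl fun i _ => Finset.sum_congr rfl fun j _ => ?_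
  ring

/-! ### Thm. 29(b): reflection positivity forces a positive semidefinite coupling matrix -/

/-- `d/dβ|₀ Re Tr(K e^{βY}) = Re Tr(K Y)` (the tree's Duhamel formula at `β = 0`). [cite: DLS1978, eq. (5)] -/
theorem hasDerivAt_re_trace_mul_exp_smul_zero {p : Type} [Fintype p] [DecidableEq p]
    (K Y : Matrix p p ℂ) :
    HasDerivAt (fun t : ℝ => (K * exp ((t : ℂ) • Y)).trace.re) ((K * Y).trace.re) 0 := by
  have hderivC := Matrix.hasDerivAt_trace_mul_exp_add_smul K 0 Y 0
  simp only [zero_smul, add_zero, smul_zero, NormedSpace.exp_zero, Matrix.mul_one, Matrix.one_mul,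
    intervalIntegral.integral_const, sub_zero, one_smul] at hderivC
  have h := Complex.reCLM.hasFDerivAt.comp_hasDerivAt (0 : ℝ) hderivC
  rw [Complex.reCLM_apply] at h
  refine h.congr_of_eventuallyEq (Eventually.of_forall fun t => ?_)
  simp only [Function.comp_apply, zero_add, Complex.coe_smul, Complex.reCLM_apply]

/-- A real function with `f 0 = 0` and a NEGATIVE derivative at `0` is negative somewhere in every
interval `(0, ε)`. [folklore] -/
private theorem exists_pos_lt_neg_of_hasDerivAt {f : ℝ → ℝ} {d ε : ℝ} (hf : HasDerivAt f d 0)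
    (h0 : f 0 = 0) (hd : d < 0) (hε : 0 < ε) : ∃ t : ℝ, 0 < t ∧ t < ε ∧ f t < 0 := by
  have hslope := hf.tendsto_slope_zero_right
  have hev : ∀ᶠ t in 𝓝[>] (0 : ℝ), t⁻¹ • (f (0 + t) - f 0) < 0 :=
    (tendsto_order.1 hslope).2 0 hd
  have hIoo : ∀ᶠ t in 𝓝[>] (0 : ℝ), t ∈ Set.Ioo (0 : ℝ) ε := Ioo_mem_nhdsGT hε
  obtain ⟨t, ht, htpos, htε⟩ := (hev.and hIoo).exists
  refine ⟨t, htpos, htε, ?_⟩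
  rw [zero_add, h0, sub_zero, smul_eq_mul] at ht
  exact neg_of_mul_neg_left (by rwa [mul_comm] at ht) (inv_pos.2 htpos).le

/-- **Failure of reflection positivity from one negative direction of the coupling matrix**
(the mechanism of Jaffe–Janssens' "only if"; the two-site ferromagnetic Heisenberg pair of
`HeisenbergFerromagnetNotReflectionPositive.lean` is the instance `A = 0`, `C = σ`, coupling matrix
`-J·1₃` with `J > 0`, `F = σᶻ`, see `HeisenbergPairRP.trace_theta_mul_exp_eq` below): if a trace-free observable `F` of the `+` half has `Re Σ_{ij} w̄_i J_{ij} w_j < 0` for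
`w_j = Tr(F C_j)`, then `β ↦ Re Tr[(F̄ ⊗ F) e^{βX}]` vanishes at `β = 0` with negative derivative, so
for every `ε > 0` some `β ∈ (0, ε)` has `Re Tr[(F̄ ⊗ F) e^{βX}] < 0` — the Boltzmann functional at
inverse temperature `β` is not reflection positive. No hermiticity of `J` is needed.
[cite: JaffeJanssens2016, §4.2 proof of Thm. 29(b)] [cite: Speer1985] -/
theorem exists_neg_of_neg_direction (A : Matrix m m ℂ) (C : ι → Matrix m m ℂ) (J : Matrix ι ι ℂ)
    {F : Matrix m m ℂ} (hF : F.trace = 0) {w : ι → ℂ} (hw : ∀ j, (F * C j).trace = w j)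
    (hneg : (star w ⬝ᵥ (J *ᵥ w)).re < 0) {ε : ℝ} (hε : 0 < ε) :
    ∃ β : ℝ, 0 < β ∧ β < ε ∧ (reflectPair F * exp ((β : ℂ) • exponent A C J)).trace.re < 0 := by
  have hderiv := hasDerivAt_re_trace_mul_exp_smul_zero (reflectPair F) (exponent A C J)
  rw [trace_reflectPair_mul_exponent A C J hF hw] at hderiv
  have h0 : (fun t : ℝ => (reflectPair F * exp ((t : ℂ) • exponent A C J)).trace.re) 0 = 0 := by
    simp only [Complex.ofReal_zero, zero_smul, NormedSpace.exp_zero, Matrix.mul_one, trace_reflectPair,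
      hF, mul_zero, Complex.zero_re]
  exact exists_pos_lt_neg_of_hasDerivAt hderiv h0 hneg hε

/-- **Jaffe–Janssens 2016, Theorem 29(b)** (FILS matrix realisation): if `J` is Hermitian (in the
paper this is reflection invariance of `H`), the observables `C_j` are dually spanned by trace-free
matrices, and the Boltzmann functional `F ↦ Tr[(F̄ ⊗ F) e^{βX}]` is reflection positive for all
`β ∈ (0, ε)` for some `ε > 0`, then the matrix of couplings across the reflection plane is positive
semidefinite. [cite: JaffeJanssens2016, Thm. 29(b)] -/
theorem posSemidef_of_nonneg (A : Matrix m m ℂ) {C : ι → Matrix m m ℂ} {J : Matrix ι ι ℂ}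
    (hJ : J.IsHermitian) (hC : DuallySpanned C) {ε : ℝ} (hε : 0 < ε)
    (hRP : ∀ β : ℝ, 0 < β → β < ε → ∀ F : Matrix m m ℂ,
      0 ≤ (reflectPair F * exp ((β : ℂ) • exponent A C J)).trace.re) :
    J.PosSemidef := by
  refine PosSemidef.of_dotProduct_mulVec_nonneg hJ fun w => ?_
  obtain ⟨F, hF, hw⟩ := hC w
  have hre : 0 ≤ (star w ⬝ᵥ (J *ᵥ w)).re := by
    by_contra hlt
    obtain ⟨β, hβ, hβε, hβneg⟩ := exists_neg_of_neg_direction A C J hF hw (not_le.1 hlt) hε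
    exact absurd (hRP β hβ hβε F) (not_le.2 hβneg)
  have him : (star w ⬝ᵥ (J *ᵥ w)).im = 0 := by
    have h := hJ.im_star_dotProduct_mulVec_self w
    simpa using h
  exact Complex.nonneg_iff.2 ⟨hre, him.symm⟩

/-- **Jaffe–Janssens 2016, Theorem 1 / Theorem 29** (FILS matrix realisation, both directions):
for a Hermitian coupling matrix `J` and observables `C_j` dually spanned by trace-free matrices, the
Boltzmann functional is reflection positive at every `β ≥ 0`,
`∀ β ≥ 0, ∀ F, 0 ≤ Re Tr[(F̄ ⊗ F) e^{βX(A,C,J)}]`, if and only if `J` is positive semidefinite.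
[cite: JaffeJanssens2016, Thm. 1 and Thm. 29] -/
theorem nonneg_forall_iff_posSemidef (A : Matrix m m ℂ) {C : ι → Matrix m m ℂ} {J : Matrix ι ι ℂ}
    (hJ : J.IsHermitian) (hC : DuallySpanned C) :
    (∀ β : ℝ, 0 ≤ β → ∀ F : Matrix m m ℂ,
        0 ≤ (reflectPair F * exp ((β : ℂ) • exponent A C J)).trace.re) ↔ J.PosSemidef := by
  refine ⟨fun h => posSemidef_of_nonneg A hJ hC zero_lt_one fun β hβ _ F => h β hβ.le F,
    fun hJ' β hβ F => (nonneg_forall_of_posSemidef A C hJ' hβ F).1⟩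

end CouplingMatrixRP

/-! ### Worked instance: the two-site Heisenberg pair, Prop. 38 in BOTH directions

Jaffe–Janssens' Proposition 38 (nearest-neighbour Heisenberg models, standard reflection
`Θ(σ^a_j) = -σ^a_{ϑ(j)}`): reflection positivity for all `β` iff the couplings across the plane are
antiferromagnetic. The two-site file `HeisenbergFerromagnetNotReflectionPositive.lean` proved the
"only if" by hand; here the pair is put in the form `X(A, C, J)` — after conjugating by `σʸ ⊗ 1`,
which turns the standard reflection into plain complex conjugation, the pair with coupling `J`
(Jaffe–Janssens' sign, `H_J = -J Σ_a σ^a ⊗ σ^a`) is `A = 0`, `C = σ`, coupling matrix `-J·1₃` — and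
BOTH directions follow from the criterion: the Boltzmann functional of the pair is reflection positive
at every `β ≥ 0` iff `J ≤ 0`. -/

namespace HeisenbergPairRP

open CouplingMatrixRP

/-- `σʸ σʸ = 1`. [folklore] -/
private theorem sigma_y_mul_self : spinHalfPauli 1 * spinHalfPauli 1 = 1 := by
  ext i j
  fin_cases i <;> fin_cases j <;> simp [spinHalfPauli, Matrix.mul_apply, Fin.sum_univ_two]

/-- `tr σ^a = 0`. [folklore] -/
private theorem trace_pauli (a : Fin 3) : (spinHalfPauli a).trace = 0 := by
  fin_cases a <;> simp [spinHalfPauli, Matrix.trace, Fin.sum_univ_two]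

/-- `tr(σ^a† σ^b) = 2 δ_{ab}`. [folklore] -/
private theorem trace_pauli_conjTranspose_mul (a b : Fin 3) :
    ((spinHalfPauli a)ᴴ * spinHalfPauli b).trace = if a = b then 2 else 0 := by
  fin_cases a <;> fin_cases b <;>
  · simp only [Matrix.trace, Matrix.diag, Matrix.mul_apply, Fin.sum_univ_two, conjTranspose_apply]
    simp [spinHalfPauli]
    try norm_num

/-- The coupling matrix of the pair in the plain-conjugation realisation: `-J · 1₃`, written as a
real diagonal matrix. [cite: JaffeJanssens2016, Prop. 38] -/
def pairCoupling (J : ℝ) : Matrix (Fin 3) (Fin 3) ℂ := diagonal fun _ => ((-J : ℝ) : ℂ)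

/-- The unitary `V = σʸ ⊗ 1` interchanging Jaffe–Janssens' standard reflection and plain complex
conjugation on the left factor. [cite: JaffeJanssens2016, Prop. 38] -/
def flipLeft : Matrix (Fin 2 × Fin 2) (Fin 2 × Fin 2) ℂ :=
  spinHalfPauli 1 ⊗ₖ (1 : Matrix (Fin 2) (Fin 2) ℂ)

/-- `V² = 1`. [folklore] -/
private theorem flipLeft_mul_self : flipLeft * flipLeft = 1 := by
  rw [flipLeft, ← mul_kronecker_mul, sigma_y_mul_self, Matrix.mul_one, one_kronecker_one]

/-- `Θ(F) F = V (F̄ ⊗ F) V`: the standard-reflection pairing is the plain-conjugation pairing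
conjugated by `V = σʸ ⊗ 1`. [cite: JaffeJanssens2016, Prop. 38] -/
theorem theta_mul_rightOp_eq (F : Matrix (Fin 2) (Fin 2) ℂ) :
    theta F * rightOp F = flipLeft * reflectPair F * flipLeft := by
  have hmap : F.map star = F.map (starRingEnd ℂ) := rfl
  rw [theta, rightOp, reflectPair, flipLeft, hmap]
  simp only [← mul_kronecker_mul, Matrix.mul_one, Matrix.one_mul]

/-- `-H_J = V X(0, σ, -J·1₃) V`: conjugated by `V`, the pair Hamiltonian is the cross term with
coupling matrix `-J·1₃` in the plain-conjugation realisation (`σʸ σ̄^a σʸ = -σ^a`).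
[cite: JaffeJanssens2016, Prop. 38] -/
theorem neg_pairHamiltonian_eq (J : ℝ) :
    -pairHamiltonian J = flipLeft * exponent 0 spinHalfPauli (pairCoupling J) * flipLeft := by
  have hdiag : ∀ i j : Fin 3, pairCoupling J i j = if i = j then ((-J : ℝ) : ℂ) else 0 := by
    intro i j
    simp [pairCoupling, diagonal_apply]
  have hcross : ∑ i, ∑ j, pairCoupling J i j • ((spinHalfPauli i).map (starRingEnd ℂ) ⊗ₖ spinHalfPauli j)
      = ∑ i, ((-J : ℝ) : ℂ) • ((spinHalfPauli i).map (starRingEnd ℂ) ⊗ₖ spinHalfPauli i) := by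
    refine Finset.sum_congr rfl fun i _ => ?_
    rw [Finset.sum_eq_single i (fun j _ hji => by rw [hdiag, if_neg (Ne.symm hji), zero_smul])
      (fun h => absurd (Finset.mem_univ i) h), hdiag, if_pos rfl]
  have hzero : (0 : Matrix (Fin 2) (Fin 2) ℂ).map (starRingEnd ℂ) = 0 := by
    ext i j; simp
  have hconj : ∀ a : Fin 3, spinHalfPauli 1 * (spinHalfPauli a).map (starRingEnd ℂ) * spinHalfPauli 1 =
      -spinHalfPauli a := fun a => sigma_y_conj_star a
  rw [exponent, hcross, hzero, zero_kronecker, kronecker_zero, zero_add, zero_add, flipLeft,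
    Finset.mul_sum, Finset.sum_mul, pairHamiltonian, neg_neg, Finset.smul_sum]
  refine Finset.sum_congr rfl fun a _ => ?_
  rw [Matrix.mul_smul, Matrix.smul_mul, ← mul_kronecker_mul, ← mul_kronecker_mul, Matrix.one_mul,
    Matrix.mul_one, hconj]
  ext ⟨i, k⟩ ⟨j, l⟩
  simp [kroneckerMap_apply, Complex.ofReal_neg]

/-- **The bridge**: Jaffe–Janssens' reflection-positivity functional of the pair at inverse temperature
`β` equals the plain-conjugation functional of `X(0, σ, -J·1₃)` at the same `β`.
[cite: JaffeJanssens2016, Prop. 38] -/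
theorem trace_theta_mul_exp_eq (F : Matrix (Fin 2) (Fin 2) ℂ) (β J : ℝ) :
    (theta F * rightOp F * exp (-((β : ℂ) • pairHamiltonian J))).trace =
      (reflectPair F * exp ((β : ℂ) • exponent 0 spinHalfPauli (pairCoupling J))).trace := by
  set X := exponent 0 spinHalfPauli (pairCoupling J) with hX
  have hV : IsUnit flipLeft := ⟨⟨flipLeft, flipLeft, flipLeft_mul_self, flipLeft_mul_self⟩, rfl⟩
  have hVinv : flipLeft⁻¹ = flipLeft := Matrix.inv_eq_left_inv flipLeft_mul_self
  have hexp : exp (-((β : ℂ) • pairHamiltonian J)) = flipLeft * exp ((β : ℂ) • X) * flipLeft := by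
    rw [← smul_neg, neg_pairHamiltonian_eq, ← hX, ← Matrix.smul_mul, ← Matrix.mul_smul]
    have h := Matrix.exp_conj flipLeft ((β : ℂ) • X) hV
    rw [hVinv] at h
    exact h
  rw [hexp, theta_mul_rightOp_eq]
  have hassoc : flipLeft * reflectPair F * flipLeft * (flipLeft * exp ((β : ℂ) • X) * flipLeft) =
      flipLeft * (reflectPair F * exp ((β : ℂ) • X)) * flipLeft := by
    simp only [Matrix.mul_assoc]
    rw [← Matrix.mul_assoc flipLeft flipLeft, flipLeft_mul_self, Matrix.one_mul]
  rw [hassoc, trace_mul_cycle, flipLeft_mul_self, Matrix.one_mul]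

/-- The Pauli matrices are dually spanned by trace-free matrices (`Tr σ^a = 0`, `Tr(σ^a† σ^b) = 2δ_{ab}`:
the spin case of the orthogonality of the monomial basis). [cite: JaffeJanssens2016, Prop. 9 and §7.1] -/
theorem duallySpanned_pauli : DuallySpanned spinHalfPauli :=
  duallySpanned_of_traceOrthogonal trace_pauli (c := 2) two_ne_zero
    (fun a => by rw [trace_pauli_conjTranspose_mul, if_pos rfl])
    (fun a b hab => by rw [trace_pauli_conjTranspose_mul, if_neg hab])

/-- **Jaffe–Janssens 2016, Prop. 38 at two sites, both directions**: the Boltzmann functional of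
the spin-½ Heisenberg pair `H_J = -J Σ_a σ^a ⊗ σ^a` is reflection positive for the standard reflection
at every `β ≥ 0` — `0 ≤ Re Tr(Θ(F) F e^{-βH_J})` for all right-site observables `F` — if and only if
the coupling across the bond is antiferromagnetic, `J ≤ 0`. ("if": Thm. 29(a) with coupling matrix
`-J·1₃ ⪰ 0`; "only if": Thm. 29(b), cf. `ferromagneticPair_not_reflectionPositive`.)
[cite: JaffeJanssens2016, Prop. 38 and Thm. 1] -/
theorem pair_reflectionPositive_iff (J : ℝ) :
    (∀ β : ℝ, 0 ≤ β → ∀ F : Matrix (Fin 2) (Fin 2) ℂ,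
        0 ≤ (theta F * rightOp F * exp (-((β : ℂ) • pairHamiltonian J))).trace.re) ↔ J ≤ 0 := by
  have hHerm : (pairCoupling J).IsHermitian :=
    isHermitian_diagonal_of_self_adjoint _ (by
      rw [IsSelfAdjoint]
      funext i
      simp [Complex.conj_ofReal])
  simp_rw [trace_theta_mul_exp_eq]
  rw [nonneg_forall_iff_posSemidef 0 hHerm duallySpanned_pauli, pairCoupling, posSemidef_diagonal_iff]
  simp only [Complex.zero_le_real, neg_nonneg, forall_const]

/-- In particular (the "if" of Prop. 38, new at two sites): the ANTIferromagnetic pair is reflection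
positive at every temperature. [cite: JaffeJanssens2016, Prop. 38] -/
theorem antiferromagneticPair_reflectionPositive {J : ℝ} (hJ : J ≤ 0) {β : ℝ} (hβ : 0 ≤ β)
    (F : Matrix (Fin 2) (Fin 2) ℂ) :
    0 ≤ (theta F * rightOp F * exp (-((β : ℂ) • pairHamiltonian J))).trace.re :=
  (pair_reflectionPositive_iff J).2 hJ β hβ F

end HeisenbergPairRP

end Literature.MathematicalPhysics.QuantumLattice

end
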